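import Summits.ABC.IUTFork.Cor312GapWitnessProvenance
import Summits.ABC.IUTFork.Cor312GapGlobalCountermodel
import HarnessLib

/-!
# TEAM A gap witness, part E: the PROVENANCE-LEVEL countermodel transferred to the GapA OF RECORD `GapGlobal`
# (support piece A-4′, abc-iut-w4-d026; proof-only)

Record-only file (D-0012) of the abc-iut cell (Cor. 3.12 cone, D-0067; `HOME/plan/ADJUDICATION-SPEC.md` §2 (G1)/(G3):
the GapA of record is abc-iut-skel's GLOBAL gap `InputStrip.StripAlgorithm.GapGlobal` — soundness of the multiradial
algorithm at the link-identified input prime-strip, [IUTchIII] Cor. 3.12 Step (xi-f), kurims `paper:url-4b091feeb646`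
p. 184 l. 19–29 — per abc-iut-plan INBOX 23:56:59Z); TAKES NO SIDE; proof-only companion of `Cor312GapWitnessProvenance`
(part C) and abc-iut-skel's `Cor312GapGlobalCountermodel` (XXVb, which transfers A1's interface-level witness through
`InputStrip.not_gapGlobal_of_not_statement`). THIS FILE: the same transfer for the PROVENANCE-LEVEL witness — for EVERY
collection of initial Θ-data `D` with `log(q) > 0`, over THE index skeleton of `D`, at a setting `P` with
`Cor312Prov.IsSettingOf D P`, typed Thm. 3.11 (i)∧(ii)∧(iii), every bridge hypothesis and `|log(q)| > 0`, the global
gap FAILS for EVERY strip algorithm over `P` (`thm311_bridgeHyps_isSettingOf_not_imp_gapGlobal`). So (G3) is STRONG at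
the interface + provenance level for the GapA of record itself, not only for the Statement and the catalogued readings
(part D). Interface/provenance level only (the witness frees the situation data and the glue, cf. part C); no judgement
on (xi-f). [claim: Mochizuki2012, status: disputed]
-/

noncomputable section

namespace Summit.ABC

namespace IUTFork

namespace Cor312Vol

open Thm311 Cor312 InputStrip Literature.IUT.HodgeTheaters NumberField

/-- Over the provenance witness `GapWitnessProv.setting v_ℚ⁰ c` (`c > 0`) EVERY strip algorithm violates the global
gap (contrapositive of abc-iut-skel's `statement_of_gapGlobal`, via `not_gapGlobal_of_not_statement`). [folklore] -/
theorem GapWitnessProv.not_gapGlobal {T : ThetaIndex} (vQ₀ : T.VQ) (c : ℝ) (hc : 0 < c)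
    (A : StripAlgorithm (GapWitnessProv.setting vQ₀ c)) : ¬ A.GapGlobal :=
  not_gapGlobal_of_not_statement (GapWitnessProv.bridgeHyps vQ₀ c hc.le) (GapWitnessProv.not_statement vQ₀ c hc) A

/-- **(G3) at the PROVENANCE level, for the GapA OF RECORD.** For EVERY collection of initial Θ-data `D` with
`log(q) > 0` there are a full situation over `Thm311.Real.thetaIndexOfInitial D` and a setting `P` that IS "the situation
of `D`" (`Cor312Prov.IsSettingOf D P`) with typed Thm. 3.11 (i)∧(ii)∧(iii) in full, every bridge hypothesis,
`|log(q)| > 0`, fillable strip-algorithm slots (`StripAlgorithm.canonical`) — and the GLOBAL gap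
`InputStrip.StripAlgorithm.GapGlobal` FALSE for EVERY strip algorithm over `P`. Hence the GapA of record is not
derivable from typed Thm. 3.11 + bridge hypotheses + provenance (abc-iut-skel's `thm311_bridgeHyps_not_imp_gapGlobal`
lifted from `toyIndex` to the index skeleton of every `D`, with `IsSettingOf`). [claim: Mochizuki2012, status: disputed] -/
theorem thm311_bridgeHyps_isSettingOf_not_imp_gapGlobal {F K Fbar : Type} [Field F] [NumberField F]
    [Field K] [NumberField K] [Algebra F K] [Field Fbar] [Algebra F Fbar] [Algebra K Fbar]
    {E : WeierstrassCurve F} [E.IsElliptic] {l : ℕ} {Pb : BadPlacePredicates K}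
    (D : InitialThetaData F K Fbar E l Pb) (hq : 0 < Cor312Prov.logq D) :
    ∃ (F₁ : FullSituation (Thm311.Real.thetaIndexOfInitial D))
      (P : Setting F₁.toLatticeSituation.toSituation) (_ : BridgeHyps P),
      Cor312Prov.IsSettingOf D P ∧ F₁.Statement ∧ P.AbsLogQPos ∧ Nonempty (StripAlgorithm P) ∧
        ∀ A : StripAlgorithm P, ¬ A.GapGlobal := by
  have hl : 0 < (l : ℝ) := by exact_mod_cast lt_of_lt_of_le (by norm_num) D.five_le_l
  have hc : 0 < Cor312Prov.absLogq D := by unfold Cor312Prov.absLogq; positivity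
  obtain ⟨v, -⟩ := (Thm311.Real.thetaIndexOfInitial D).Vbad_nonempty
  exact ⟨GapWitnessProv.full ((Thm311.Real.thetaIndexOfInitial D).over v) (Cor312Prov.absLogq D),
    GapWitnessProv.setting ((Thm311.Real.thetaIndexOfInitial D).over v) (Cor312Prov.absLogq D),
    GapWitnessProv.bridgeHyps _ _ hc.le, Cor312Prov.isSettingOf_ofInitial D _ (GapWitnessProv.negLogQ_eq _ _),
    GapWitnessProv.full_statement _ _, GapWitnessProv.absLogQPos _ _ hc, ⟨StripAlgorithm.canonical _⟩,
    GapWitnessProv.not_gapGlobal _ _ hc⟩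

end Cor312Vol

end IUTFork

end Summit.ABC

end
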